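import Mathlib
import HarnessLib
import Literature.Analysis.FluidPDE.RadialCalculus
import Summits.NavierStokesRegularity.NavierStokesRegularity.Theorems.UnthreadedDoorAntidynamoSphereChord
import Summits.NavierStokesRegularity.NavierStokesRegularity.Theorems.UnthreadedDoorAntidynamoSpherePathCoefficient
import Summits.NavierStokesRegularity.NavierStokesRegularity.Theorems.UnthreadedDoorAntidynamoRadialGradientUnthreaded

/-!
# Route `UnthreadedDoor` / `ThreadingFlux`, crux `PoloidalLiouville` (stmt-NavierStokesRegularity-1222), antidynamo v2 skeleton
# (sha16 `4ebf5683127b`), rung `stub_singleDegreeRung` (BC5): SPHERE CONSTANCY OF FUNCTIONS WITH RADIAL GRADIENT (profile geometry, 1/2)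

Support file (seat leafhand-ns-unthreadeddoor-1 g0, cell decomp-ns), `--supports stmt-NavierStokesRegularity-1222 --as helper`; theorems only.
First half of the non-degeneracy of harmonic homogeneous profiles (the two remaining profile hypotheses of step S2,
`…AntidynamoVorticityStructure.exists_analytic_coeff_curl_eq`): if `∇Q × y ≡ 0` then `Q` is constant on every sphere about `0`
(integrate along the normalised chords of `…AntidynamoSphereChord`, velocity `⊥` position; antipodes through a third point), hence
`Q = Q(e₀) ‖y‖ˡ` off the origin when `Q` is positively homogeneous of degree `l`; and such a `Q` vanishes at the origin when `l ≥ 1`.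

* `comp_sphereCurve_const`, `sphereConst_of_cross_gradient_eq_zero`, `eq_mul_norm_pow_of_cross_gradient_eq_zero`, `eq_zero_at_zero_of_homogeneous`.

HONEST LABEL: elementary; nothing here bears on `PoloidalLiouville` (1222) or NS regularity. [folklore]
-/

noncomputable section

-- the summit and its single sub-problem share the name (CONVENTIONS §1)
set_option linter.dupNamespace false

open scoped Topology InnerProductSpace RealInnerProductSpace ContDiff Laplacian
open Filter Set Function Metric
open Literature.Analysis.FluidPDE

namespace Summit.NavierStokesRegularity.NavierStokesRegularity.Theorems.PoloidalLiouville.Antidynamo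

/-- Along a unit-sphere curve scaled to radius `ρ`, a function whose gradient is everywhere radial is constant. [folklore] -/
theorem comp_sphereCurve_const {Q : EuclideanSpace ℝ (Fin 3) → ℝ} (hQ : Differentiable ℝ Q)
    (hrad : ∀ y, cross (gradient Q y) y = 0) {γ : ℝ → EuclideanSpace ℝ (Fin 3)} (hγd : Differentiable ℝ γ)
    (hγ1 : ∀ τ, ‖γ τ‖ = 1) (ρ : ℝ) (τ₁ τ₂ : ℝ) : Q (ρ • γ τ₁) = Q (ρ • γ τ₂) := by
  have hderiv : ∀ τ, HasDerivAt (fun t => Q (ρ • γ t)) 0 τ := by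
    intro τ
    have hin : HasDerivAt (fun t => ρ • γ t) (ρ • deriv γ τ) τ := (hγd τ).hasDerivAt.const_smul ρ
    have hφ' : HasFDerivAt Q ((InnerProductSpace.toDual ℝ (EuclideanSpace ℝ (Fin 3))) (gradient Q (ρ • γ τ))) (ρ • γ τ) :=
      (hQ _).hasGradientAt.hasFDerivAt
    refine (hφ'.comp_hasDerivAt τ hin).congr_deriv ?_
    rw [InnerProductSpace.toDual_apply_apply]
    by_cases hz : ρ • γ τ = 0
    · -- `ρ = 0`: the curve is constant `0`
      have hρ : ρ = 0 := by
        rcases smul_eq_zero.1 hz with h | h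
        · exact h
        · exfalso; have := hγ1 τ; rw [h, norm_zero] at this; exact zero_ne_one this
      simp only [hρ, zero_smul, inner_zero_right]
    · rw [eq_smul_of_cross_eq_zero hz (hrad _)]
      simp only [real_inner_smul_left, real_inner_smul_right, inner_self_deriv_eq_zero_of_norm_eq_one hγd hγ1 τ,
        mul_zero]
  have hdiff : Differentiable ℝ fun t => Q (ρ • γ t) := fun τ => (hderiv τ).differentiableAt
  exact is_const_of_deriv_eq_zero hdiff (fun τ => (hderiv τ).deriv) τ₁ τ₂

/-- SPHERE CONSTANCY: if `∇Q × y ≡ 0` then `Q y₁ = Q y₂` whenever `‖y₁‖ = ‖y₂‖`. [folklore] -/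
theorem sphereConst_of_cross_gradient_eq_zero {Q : EuclideanSpace ℝ (Fin 3) → ℝ} (hQ : Differentiable ℝ Q)
    (hrad : ∀ y, cross (gradient Q y) y = 0) {y₁ y₂ : EuclideanSpace ℝ (Fin 3)} (hn : ‖y₁‖ = ‖y₂‖) : Q y₁ = Q y₂ := by
  by_cases h0 : y₁ = 0
  · have : y₂ = 0 := by rw [← norm_eq_zero, ← hn, h0, norm_zero]
    rw [h0, this]
  set ρ : ℝ := ‖y₁‖ with hρ
  have hρ0 : 0 < ρ := norm_pos_iff.2 h0
  have hy₂0 : y₂ ≠ 0 := by rw [← norm_ne_zero_iff, ← hn]; exact hρ0.ne'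
  -- unit directions
  set θ₁ : EuclideanSpace ℝ (Fin 3) := ρ⁻¹ • y₁ with hθ₁
  set θ₂ : EuclideanSpace ℝ (Fin 3) := ρ⁻¹ • y₂ with hθ₂
  have hθ₁1 : ‖θ₁‖ = 1 := by rw [hθ₁, norm_smul, Real.norm_eq_abs, abs_of_pos (inv_pos.2 hρ0), inv_mul_cancel₀ hρ0.ne']
  have hθ₂1 : ‖θ₂‖ = 1 := by
    rw [hθ₂, norm_smul, Real.norm_eq_abs, abs_of_pos (inv_pos.2 hρ0), ← hn, inv_mul_cancel₀ hρ0.ne']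
  have hy₁θ : y₁ = ρ • θ₁ := by rw [hθ₁, smul_smul, mul_inv_cancel₀ hρ0.ne', one_smul]
  have hy₂θ : y₂ = ρ • θ₂ := by rw [hθ₂, smul_smul, mul_inv_cancel₀ hρ0.ne', one_smul]
  -- joining two non-antipodal unit vectors
  have join : ∀ a b : EuclideanSpace ℝ (Fin 3), ‖a‖ = 1 → ‖b‖ = 1 → b ≠ -a → Q (ρ • a) = Q (ρ • b) := by
    intro a b ha hb hab
    obtain ⟨γ, hγs, hγ1, hγ0, hγone, -⟩ := exists_smooth_sphereCurve ha hb hab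
    have := comp_sphereCurve_const hQ hrad (hγs.differentiable (by simp)) hγ1 ρ 0 1
    rwa [hγ0, hγone] at this
  rw [hy₁θ, hy₂θ]
  by_cases hanti : θ₂ = -θ₁
  · -- through a third point: one of the first two basis vectors is not `±θ₁`
    set e0 : EuclideanSpace ℝ (Fin 3) := EuclideanSpace.single 0 1 with he0
    set e1 : EuclideanSpace ℝ (Fin 3) := EuclideanSpace.single 1 1 with he1
    have he0n : ‖e0‖ = 1 := by rw [he0, EuclideanSpace.norm_eq]; simp
    have he1n : ‖e1‖ = 1 := by rw [he1, EuclideanSpace.norm_eq]; simp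
    have he01 : e0 ≠ e1 := by
      intro h; have := congrArg (fun v : EuclideanSpace ℝ (Fin 3) => v 0) h; simp [he0, he1] at this
    have he01' : e0 ≠ -e1 := by
      intro h; have := congrArg (fun v : EuclideanSpace ℝ (Fin 3) => v 0) h; simp [he0, he1] at this
    -- choose `e ∈ {e0, e1}` with `e ≠ θ₁` and `e ≠ -θ₁`
    obtain ⟨e, hen, he₁, he₂⟩ : ∃ e : EuclideanSpace ℝ (Fin 3), ‖e‖ = 1 ∧ e ≠ -θ₁ ∧ e ≠ θ₁ := by
      by_cases h1 : e0 = θ₁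
      · refine ⟨e1, he1n, ?_, ?_⟩
        · intro h; apply he01'; rw [h1, h, neg_neg]
        · intro h; exact he01 (h1.trans h.symm)
      by_cases h2 : e0 = -θ₁
      · refine ⟨e1, he1n, ?_, ?_⟩
        · intro h; exact he01 (h2.trans h.symm)
        · intro h; apply he01'; rw [h]; exact h2
      · exact ⟨e0, he0n, h2, h1⟩
    have hA := join θ₁ e hθ₁1 hen he₁
    have hB := join e θ₂ hen hθ₂1 (by
      rw [hanti]
      exact fun h => he₂ (neg_injective h).symm)
    exact hA.trans hB
  · exact join θ₁ θ₂ hθ₁1 hθ₂1 hanti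

/-- RADIAL FORM: sphere constancy + positive homogeneity give `Q y = Q(e₀) ‖y‖ ^ l` off the origin. [folklore] -/
theorem eq_mul_norm_pow_of_cross_gradient_eq_zero {Q : EuclideanSpace ℝ (Fin 3) → ℝ} (hQ : Differentiable ℝ Q) {l : ℕ}
    (hhom : ∀ r : ℝ, 0 < r → ∀ y : EuclideanSpace ℝ (Fin 3), Q (r • y) = r ^ l * Q y)
    (hrad : ∀ y, cross (gradient Q y) y = 0) :
    ∀ y : EuclideanSpace ℝ (Fin 3), y ≠ 0 → Q y = Q (EuclideanSpace.single 0 1) * ‖y‖ ^ l := by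
  intro y hy
  have hn : 0 < ‖y‖ := norm_pos_iff.2 hy
  have h1 : Q y = ‖y‖ ^ l * Q (‖y‖⁻¹ • y) := by
    have := hhom ‖y‖ hn (‖y‖⁻¹ • y)
    rwa [smul_smul, mul_inv_cancel₀ hn.ne', one_smul] at this
  have he : ‖(EuclideanSpace.single 0 1 : EuclideanSpace ℝ (Fin 3))‖ = 1 := by
    rw [EuclideanSpace.norm_eq]; simp
  have hu : ‖‖y‖⁻¹ • y‖ = ‖(EuclideanSpace.single 0 1 : EuclideanSpace ℝ (Fin 3))‖ := by
    rw [he, norm_smul, Real.norm_eq_abs, abs_of_pos (inv_pos.2 hn), inv_mul_cancel₀ hn.ne']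
  rw [h1, sphereConst_of_cross_gradient_eq_zero hQ hrad hu, mul_comm]

/-- A positively homogeneous function of degree `l ≥ 1` vanishes at the origin. [folklore] -/
theorem eq_zero_at_zero_of_homogeneous {Q : EuclideanSpace ℝ (Fin 3) → ℝ} {l : ℕ} (hl : 1 ≤ l)
    (hhom : ∀ r : ℝ, 0 < r → ∀ y : EuclideanSpace ℝ (Fin 3), Q (r • y) = r ^ l * Q y) : Q 0 = 0 := by
  have h := hhom 2 two_pos 0
  rw [smul_zero] at h
  have h2 : (1 : ℝ) < 2 ^ l := one_lt_pow₀ (by norm_num) (by omega)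
  have : ((2 : ℝ) ^ l - 1) * Q 0 = 0 := by linarith
  rcases mul_eq_zero.1 this with h' | h'
  · linarith
  · exact h'

end Summit.NavierStokesRegularity.NavierStokesRegularity.Theorems.PoloidalLiouville.Antidynamo

end
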